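import Mathlib
import HarnessLib
import HarnessLib.Audit
import Summits.PneNP.Statement
import Literature.Computability.Complexity.Classes
import Literature.Computability.Complexity.Nondeterministic
import Literature.Computability.Complexity.Reductions
import Literature.Computability.Complexity.GraphEncodings
import Literature.Computability.Complexity.KarpProblems
import Literature.Computability.MetaComplexity.SumOfSquares
import HarnessLib.Audit.Status.Attr

/-!
Route: DescentTower

DORMANT since 2026-08-23T00:32:25Z (reconciler: no traction for 5.8 d (last activity item-evidence-added at 2026-08-17T04:57:41Z); parked, not closed — `ledger route dormant route-PneNP-DescentTower --off` to reactivate) — unstaffed, not closed; items shared with open routes are served there. `ledger route dormant <id> --off` reactivates.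

# Route PneNP/DescentTower — "Hasse fails, Brauer–Manin fails: 3-colourability defeats every finite
descent obstruction, and polynomial time sees nothing else" (card
PneNP/PneNP/descent-tower-insufficiency-three-col)

## Thesis X (it suffices to show)
Words: 3-COLOURABILITY is not in P, obtained as INSUFFICIENCY ∧ CAPTURE of the descent tower.
Insufficiency (provable layer): for every sublinear level k(n) = o(n) and all large n some
non-3-colourable n-vertex graph is accepted by the coupled level-k(n) obstruction — a degree-2k SOS
pseudoexpectation (the archimedean place) all of whose positively weighted partial colourings on ≤ k
vertices are ℤ-extendable inside its support (Ó Conghaile's cohomological k-consistency = abelian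
descent at the finite places). Capture (summit layer): every polynomial-time sound refuter of
3-colourability is dominated by some sublinear level.
Lean (decl ThreeColNotInP, elaborates):
`Literature.Computability.Complexity.encodingGraph.toLanguage {G : Σ n, SimpleGraph (Fin n) |
G.2.Colorable 3} ∉ Literature.Computability.Complexity.Classes.P`; the decomposition is the typed
glue `TargetOfCruxes : CaptureSublinear → JointSublinearFooling → ThreeColNotInP` (provable now,
checked in the planner's Sketch.lean).

## Assembly X → PneNP
`Assembly : ThreeColKarpReducibleChromatic → ThreeColNotInP → PneNP` (rev 2, bridge-free; provable
NOW, planner-checked rc 0 with standard axioms: 3-COL ≤ₚ CHROMATIC ∈ NP by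
ChromaticNP.CHROMATIC_mem_NP and mem_NP_of_karpReducible_holds puts 3-COL in Nondeterministic.NP,
and the PROVED model bridges np_bool_eq (NPBridge) / P_bool_eq_holds (ClayProblem) move `3-COL ∈ NP
∖ P` to Cook's classes PNPWave0.NP Bool / PNPWave0.P Bool of the Statement — the bridges are used
INSIDE that proof, in a Theorems file, never as hypotheses). Deciding theorem (D-0027 §2.1): `closes
: ThreeColNotInP → ThreeColKarpReducibleChromatic → Assembly → PneNP := fun hT hK hA => hA hK hT`.
The route file imports neither ClayProblem (whose open conjecture NPNotSubsetPPoly is not used by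
any thesis) nor ChromaticNP: import cone = Statement + Classes / Nondeterministic / Reductions /
GraphEncodings / KarpProblems + MetaComplexity.SumOfSquares, all proved. The cruxes enter through
TargetOfCruxes (CaptureSublinear → JointSublinearFooling → ThreeColNotInP).

## Two-layer plan (D-0019): cruxes first, glue later
Layer 1 (typed now, ranked): JointSublinearFooling (3) · CaptureSublinear (4) —
CohConsistencyFooledByThreeCol (rank 2) was re-badged SUPPORT by retriage (known in print for K₃
directly: Conneryd–Ghannane–Pang 2025 Thm 6.1, in tree as a cite fact) and CaptureSublinear carries
the recorded objection 'explicit-B ⇒ ¬C' (see its why-might-fail). Support (rank 9, all typed):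
TargetOfCruxes (glue, provable now), ThreeColKarpReducibleChromatic (routine machine; a complete
candidate proof is attached to the item), Assembly (rank 1, bridge-free, provable now), LevelsSound
(definition sanity, provable now), FixingAbsorption (nested fixing ⟸ width doubling, provable now;
it retires the card's OR-depth crux). Layer 2 (only after a crux closes): split
JointSublinearFooling into SOS part / ℤ part / coupling on one instance family; split
CaptureSublinear by refuter class (FPC-definable → template-uniform CSP algorithms → proof search
p-simulated by SOS + linear algebra → all of P).

Rationale: ## Why this line (widen: arithmetic of rational points ↦ CSP relaxation hierarchies; proof
complexity; finite model theory)
The card's dictionary is checkable line by line: instance ↦ variety, solution ↦ rational point,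
k-consistency ↦ local solubility (Hasse), Ó Conghaile's cohomological k-consistency
[doi:10.4230/lipics.mfcs.2022.75, Def. 5; Thm 'rings': it decides linear systems over every finite
ring] ↦ Brauer–Manin / abelian descent, its unconditional insufficiency on an NP-complete designed
template [arXiv:2407.09097, Thm 1.2 of v3 = ICALP 2025 Thm 1.3] and on random lax null-constraining
templates [doi:10.1145/3717823.3718301] ↦ Skorobogatov 1999. What the planner ADDS: (i) the
archimedean place — X(ℝ) ≠ ∅ ↔ no Positivstellensatz refutation ↔ an SOS/Lasserre pseudoexpectation
exists — so 'locally soluble at all places and unobstructed by abelian descent' becomes ONE coupled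
level (crux B's object: pseudoexpectation E + ℤ-sections supported on E > 0), which dominates every
universal CSP algorithm in print (bounded width, Sherali–Adams, Lasserre, AIP, BLP+AIP, BAᵏ, CLAP,
SDA, cohomological consistency); (ii) FixingAbsorption (support, provable now): singleton/nested
fixing at width k is implied by plain cohomological 2k-consistency, so the card's
fixing-depth/OR-depth hierarchy (its crux C1) collapses into the width axis for every constant or
sublinear level — its base case is Lichter–Pago's theorem — and is NOT filed; (iii) capture by a
FIXED level is false by padding (brute force on O(log n)-size components), and an UNcoupled union
'SOS or ℤ' would miss BAᵏ-type refuters — hence sublinear levels k(n) = o(n) and the coupled object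
in cruxes B, C; (iv) the card's non-abelian descent level and Jordan–Hölder crux (C2) are NOT filed:
selecting an everywhere-locally-soluble twist is a Γ-equation instance, NP-hard for non-abelian Γ
(Goldmann–Russell 2002), so no polynomial-time level is in sight (arithmetic agrees: finite ABELIAN
descent = algebraic Brauer–Manin, and Poonen's insufficiency [arXiv:0806.1312] lives in the
non-abelian surplus) — an open design question, recorded. Imported: from arithmetic geometry the
SHAPE of the tower and of its counterexamples (fibrations/disjunctions of individually affine pieces
= OR-glued coprime Tseitin systems); from proof complexity the engines (Tseitin contradictions on
expanders, Grigoriev–Schoenebeck pseudoexpectations as in arXiv:1701.04521, Berkholz–Grohe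
p-solutions, Tulsiani's gadget transfer doi:10.1145/1536414.1536457, Chan–Ng–Peng's closure
framework doi:10.1145/3618260.3649613); from finite model theory the capture precedent (Dawar–Wang
doi:10.1109/lics.2017.8005108: FPC-definability of SDP turns counting-width lower bounds into Ω(n)
Lasserre levels for every unbounded-width template, K₃ included). No physical analogy; the
dictionary is arithmetic ↔ combinatorial and every line is a theorem or a definition.
## Ranked cruxes (all elaborate: Sketch2.lean rc 0 in the gate's file shape)
#2 CohConsistencyFooledByThreeCol — ∀ k some non-3-colourable graph passes Ó Conghaile's level (Def.
5 inlined over SimpleGraph (Fin n)). First rung; isolates the single unknown ingredient (does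
per-section ℤ-fixing survive on K₃?). Why it might fail: may already follow from Chan–Ng II if K₃ is
lax + null-constraining (paywalled, acq-01882; then it becomes a cite); transfer from the designed
template needs gadget monotonicity (informal support TransferUnderGadgets).
#3 JointSublinearFooling — X_desc: ∀ k(n) = o(n), eventually a non-3-colourable n-vertex graph
accepted by the coupled SOS ⋈ ℤ level k(n). Why: the OR-gluing that kills ℤ-sections may break
pseudoexpectations; coupling the two supports on one instance family is new.
#4 CaptureSublinear — every sound P-refuter of 3-colourability is dominated by a sublinear coupled
level. Summit strength: with #3 it gives X (TargetOfCruxes); relativization bites exactly here.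
Restricted forms are theorems-in-waiting or litmus tests (FPC-definable refuters via Dawar–Wang;
template-uniform algorithms — Lichter–Pago's open question p. 5; proof search in systems p-simulated
by SOS + linear algebra, Berkholz 2018).
Ranking = information per unit of effort now; #4 carries the summit strength and is flagged as such.
## Kill criteria
LevelsSound refuted ⇒ the inline levels are mis-rendered: restate #2–#4 (repair, not kill). #2
refuted for some k ⇒ a P = NP-strength event (cohomological k-consistency decides 3-COL): route
closed, collapse recorded. #4 refuted by an explicit refuter class ⇒ enrich the level once (e.g.
SOS-conditioning interleaved with ℤ-fixing; 𝔽_p-polynomial calculus) and restate #3/#4; a second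
structural escape closes the route as 'polynomial time is not of finite descent type'.
FixingAbsorption refuted ⇒ resurrect the OR-depth crux (card C1) as #5.
## Deliberately NOT decomposed yet
The instance family for #3 (which expanders, which OR gadget, which pp-interpretation in K₃); the
transfer lemma 'cohomological consistency is monotone under pp-interpretations' (informal support;
general-structure definitions requested); non-abelian descent (above); finite-ring coefficient
variants (ℤ is universal, weaker levels are fooled a fortiori); template-uniform capture (needs CSP
templates in Lean); kit experiments (cohomological 4-,5-consistency on OR-glued Tseitin graphs
reduced to 3-COL, n ≤ 60) are welcome census evidence for #2. Sources:
doi:10.4230/lipics.mfcs.2022.75; arXiv:2407.09097; doi:10.1145/3618260.3649613;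
doi:10.1145/3717823.3718301; doi:10.1109/lics.2017.8005108; doi:10.1145/1536414.1536457;
arXiv:1701.04521; arXiv:2301.05084; arXiv:0806.1312; Karp1972; BakerGillSolovay1975.

Novelty: Searched 2026-08-15: `lit search` 'cohomological k-consistency' (searchd rc 75; OpenAlex/S2/arXiv
429); crossref 'How Random CSPs Fool Hierarchies' → doi:10.1145/3618260.3649613 (READ §1, §4.3, §6:
neutrality excludes graph colouring; Q1.4–1.5), doi:10.1145/3717823.3718301 (paywalled, acq-01882);
READ arXiv:2407.09097 pp.4–5 (Thms 1.1–1.2, open question, fixing), arXiv:2206.15253 §4–6 (Def. 5,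
Prop. 6, Q14–17), doi:10.1109/lics.2017.8005108 (Thms 6–7, Lemmas 9–10); galaxy --star all 'Random
CSPs Fool Hierarchies' 0 rows; plus the card's and two auditors' searches (no arithmetic-descent ↔
CSP-hierarchy join in print; Carù arXiv:1701.00656 the only 'above the abelian level' precedent,
contextuality-internal). Nearest prior art: Ó Conghaile 2022 + Lichter–Pago 2025 + Chan–Ng 2025
(abelian level; insufficiency on designed/random NP-complete templates); Dawar–Wang 2017
(capture-by-definability ⇒ hierarchy lower bounds). Delta: (1) dictionary extended by the
archimedean place (SOS pseudoexpectation = X(ℝ)) giving ONE coupled level dominating every universal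
CSP algorithm in print, typed in Lean; (2) FixingAbsorption (nested fixing ⟸ width doubling) prunes
the card's OR-depth hierarchy to its known base case; (3) capture stated non-vacuously (sound
P-refuters dominated by SUBLINEAR coupled levels) with typed glue to 3-COL ∉ P; (4) non-abelian
level diagnosed non-polynomial (twist selection = Γ-equations). Expected grade: new-combination.  [refs: 10.1145/3618260.3649613, 10.1145/3717823.3718301, 10.1109/lics.2017.8005108, 2407.09097, 2206.15253, 1701.00656, doi:10.1145/3618260.3649613, doi:10.1145/3717823.3718301, doi:10.1109/lics.2017.8005108]

Barriers (technique_class: consistency-hierarchy-lower-bounds, capture): - Literature.Barriers.PneNP.Relativization and Literature.Barriers.PneNP.BoundedRelativization and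
Literature.Barriers.PneNP.Algebrization : bite ONLY at CaptureSublinear — a PSPACE-complete oracle
gives a complete P-refuter while crux B's fooling graphs persist, so capture is false relativized
and needs the explicit structure of P (the bet, not evaded); cruxes A, B are oracle-free statements
about explicit relaxations on explicit graphs, untouched.
- Literature.Barriers.PneNP.NaturalProofs and Literature.Barriers.PneNP.NaturalProofsTC0 : not
applicable — no constructive large property of truth tables; lower bounds against named relaxations
via instance constructions.
- Literature.Barriers.PneNP.LowDegreeCounterexamples : its lesson (exact linear algebra escapes
moment/degree hierarchies) is absorbed BY DESIGN — the ℤ-part of the coupled level decides all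
linear systems over finite rings (Ó Conghaile Thm 'rings'); the residual risk (a third escape:
neither local nor PSD nor affine) is exactly CaptureSublinear's why-might-fail.
- Literature.Barriers.PneNP.TSPExtensionComplexity and
Literature.Barriers.PneNP.TSPExtensionComplexityNarrow : constrain LP/SDP formats for proving P =
NP; here hierarchies are lower-bound targets, never claimed complete — not applicable.
- Literature.Barriers.PneNP.ApproximationMethodLimit and Literature.Barriers.PneNP.MonotoneGap : no
circuit lower bound claimed — not applicable. Negatives index: 0 refuted PneNP statements
(2026-08-15).

History (route lifecycle, newest last):
- 2026-08-15T16:21:09Z · rev 2: restated Assembly (stmt-PneNP-2544) — route-repair rbadge-g2 (cone guardrail + glue): (a) RE-ROUTED around Literature.Computability.Complexity.NPNotSubsetPPoly — it is an OPEN CONJECTURE def that no (planner-rbadge-PneNP-DescentTower-5d67ad1f-g2-0)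
- 2026-08-16T04:13:58Z · AUTO-CRUX (backfill): ThreeColNotInP — hypotheses of the deciding theorem that nothing in the route derives are cruxes (operator:999:1085951)
- 2026-08-23T00:32:25Z · DORMANT — reconciler: no traction for 5.8 d (last activity item-evidence-added at 2026-08-17T04:57:41Z); parked, not closed — `ledger route dormant route-PneNP-DescentTow (operator:999:2424848)

sub-problem: PneNP · status: dormant · opened planner-plancard-PneNP-PneNP-descent-tower-in-89ae27e4-0 2026-08-15T11:05:28Z · rev 4 · ledger route-PneNP-DescentTower
GENERATED by the gate from the ledger (D-0016/17). Provers cite these decls: `theorem foo : Summit.PneNP.PneNP.Theses.DescentTower.<Decl> := …` in Summits/PneNP/PneNP/Theorems/<Name>.lean.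
-/

namespace Summit.PneNP.PneNP.Theses.DescentTower

open scoped BigOperators Topology Manifold Classical MeasureTheory ProbabilityTheory Matrix InnerProductSpace ComplexConjugate ContinuousMap
open Filter Set Function TopologicalSpace MeasureTheory

attribute [summit_statement] _root_.PneNP

open Literature.PNP

/-- item stmt-PneNP-2536 · crux (kind.auto-crux: conjecture-grade) · rank 0 · open · by planner
why it might fail: Karp-equivalent to P ≠ NP (3-COL NP-complete: Karp 1972, Garey–Johnson–Stockmeyer 1976): false iff P = NP. Caution: the glue TargetOfCruxes needs B and C together, but an EXPLICIT proof of B refutes C as filed (see CaptureSublinear).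
sources: Karp1972, doi:10.1016/0304-3975(76)90059-1, GareyJohnson1979, BakerGillSolovay1975
[target] X: 3-COLOURABILITY (= CSP(K₃): encodingGraph-codes of finite graphs G with G.Colorable 3)
is not in P. Karp-equivalent to the summit (Garey–Johnson–Stockmeyer 1976), so by itself
uninformative; the CONTENT of the route is the typed two-layer decomposition X ⇐ CaptureSublinear ∧
JointSublinearFooling (glue TargetOfCruxes, provable now): the descent tower — local consistency =
local solubility, Ó Conghaile's cohomological ℤ-consistency = abelian descent / Brauer–Manin at the
finite places, degree-2k SOS = the archimedean place — never certifies non-3-colourability at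
sublinear level (provable layer), and every polynomial-time sound refuter is dominated by a
sublinear level (summit layer). [card descent-tower-insufficiency-three-col] -/
@[route_item "route-PneNP-DescentTower", crux]
def ThreeColNotInP : Prop :=
  Literature.Computability.Complexity.encodingGraph.toLanguage {G : Σ n, SimpleGraph (Fin n) | G.2.Colorable 3} ∉ Literature.Computability.Complexity.Classes.P

/-- item stmt-PneNP-17734 · crux · rank 2 · open · by planner
why it might fail: A hom-monotone THIRD ESCAPE, neither local nor PSD nor affine: e.g. topological refuters (𝔽₂-index of bounded-scale box complexes B_d(G), Lovász 1978: functorial under →g, poly-size linear algebra) on some bounded-degree expander family fooling every sublinear SOS⋈ℤ level. Relativization bites.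
sources: doi:10.1016/0097-3165(78)90022-5, doi:10.1145/1206035.1206036, doi:10.1016/0095-8956(90)90132-J, arXiv:2003.11351, LichterPago2025, DawarRicherbyRossman2008
[crux] [C' — CAPTURE FOR HOMOMORPHISM-MONOTONE REFUTERS; replaces CaptureSublinear in the derivation
of ThreeColNotInP] Every polynomial-time SOUND refuter R of 3-colourability (no code of a
3-colourable graph in R) that is HOMOMORPHISM-MONOTONE on graph codes (G →g H and G flagged ⇒ H
flagged — exactly the closure property of the complete refuter NON-3-COL, the only refuter the glue
ever feeds in) is dominated by a sublinear coupled SOS⋈ℤ level: ∃ k(n)=o(n), eventually every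
n-vertex graph flagged by R is rejected by crux B's level at k(n). WEAKER than CaptureSublinear (one
extra hypothesis; CaptureSublinear → CaptureHom is `fun h R hP hs _ => h R hP hs`) and immune to the
recorded objection against it: an explicit linear-fooling family {G_n} is a sound P-refuter but NOT
hom-monotone, and its hom-closure {H : ∃ n, G_n →g H} is not known (nor believed) to be in P
(left-hand-side-restricted homomorphism problems with cores of unbounded treewidth are W[1]-hard,
Grohe 2007; single-pattern closures {H : F →g H} ARE dominated, at constant level |F|, because level
acceptance pulls back along homomorphisms). Equivalent lattice form: among polynomial-time decidable
homomorphism-closed rela -/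
@[route_item "route-PneNP-DescentTower"]
def CaptureHom : Prop :=
  ∀ R : Language Bool, R ∈ Literature.Computability.Complexity.Classes.P → (∀ (n : ℕ) (G : SimpleGraph (Fin n)), Literature.Computability.Complexity.encodingGraph.encode ⟨n, G⟩ ∈ R → ¬ G.Colorable 3) → (∀ (n m : ℕ) (G : SimpleGraph (Fin n)) (H : SimpleGraph (Fin m)), Nonempty (G →g H) → Literature.Computability.Complexity.encodingGraph.encode ⟨n, G⟩ ∈ R → Literature.Computability.Complexity.encodingGraph.encode ⟨m, H⟩ ∈ R) → ∃ k : ℕ → ℕ, Filter.Tendsto (fun n : ℕ => (k n : ℝ) / n) Filter.atTop (nhds 0) ∧ ∀ᶠ n : ℕ in Filter.atTop, ∀ G : SimpleGraph (Fin n), Literature.Computability.Complexity.encodingGraph.encode ⟨n, G⟩ ∈ R → ¬ (∃ E : MvPolynomial ℕ ℝ →ₗ[ℝ] ℝ, Literature.Computability.MetaComplexity.IsPseudoexpectation (2 * (k n)) E ∧ (∀ i : ℕ, Literature.Computability.MetaComplexity.SatisfiesIdentity (2 * (k n)) E (Literature.Computability.MetaComplexity.boolAxiom i)) ∧ (∀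 v : Fin n, Literature.Computability.MetaComplexity.SatisfiesIdentity (2 * (k n)) E (1 - ∑ c : Fin 3, MvPolynomial.X (3 * v.val + c.val))) ∧ (∀ u v : Fin n, G.Adj u v → ∀ c : Fin 3, Literature.Computability.MetaComplexity.SatisfiesIdentity (2 * (k n)) E (MvPolynomial.X (3 * u.val + c.val) * MvPolynomial.X (3 * v.val + c.val))) ∧ ∀ p : Finset (Fin n) × (Fin n → Fin 3), p.1.card ≤ (k n) → (∀ v, v ∉ p.1 → p.2 v = 0) → 0 < E (∏ v ∈ p.1, MvPolynomial.X (3 * v.val + (p.2 v).val)) → ∃ r : Finset (Fin n) → (Fin n → Fin 3) → ℤ, (∀ U t, r U t ≠ 0 → U.card ≤ (k n) ∧ (∀ v, v ∉ U → t v = 0) ∧ 0 < E (∏ v ∈ U, MvPolynomial.X (3 * v.val + (t v).val))) ∧ (∀ U D : Finset (Fin n), D ⊆ U → U.card ≤ (k n) → ∀ t' : Fin n → Fin 3, r D t' = ∑ t : Fin n → Fin 3, if (∀ v, t' v = if v ∈ D then t v else 0) then r U t else 0) ∧ r p.1 p.2 = 1 ∧ ∀ t, t ≠ p.2 → r p.1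 t = 0)

/-- item stmt-PneNP-2538 · crux · rank 3 · open · by planner
why it might fail: As quantified (∀ k=o(n), eventually) it is EQUIVALENT to LINEAR-level fooling (∃c>0: level ⌊cn⌋ ∀ large n). Its object, strong SDP+AIP, is the one combination with no lower bound in print (Chan–Ng II p.10; cf. BKM arXiv:2408.15377): conditioning E on a section may leave no affine solution in supp E.
sources: doi:10.1145/3717823.3718301, LichterPago2025, doi:10.1145/3618260.3649613, KothariEtAl2017, arXiv:2408.15377, doi:10.1016/S0304-3975(00)00157-2
[crux B — X_desc, the provable layer at full typed strength] For every sublinear k(n) = o(n) and all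
large n some non-3-colourable n-vertex graph is accepted by the COUPLED level k(n): a degree-2k
pseudoexpectation E for the 0/1 system x_{v,c} (Booleanity, Σ_c x_{v,c} = 1, x_{u,c}·x_{v,c} = 0 on
edges; tree defs IsPseudoexpectation/SatisfiesIdentity, variable x_{v,c} = X(3v+c)) such that every
section (C,s), |C| ≤ k, with E(∏_{v∈C} x_{v,s v}) > 0 is ℤ-extendable INSIDE the positive support
(contexts ≤ k, r_C = 1·s). Dictionary: E = the archimedean local point (no Positivstellensatz
refutation ↔ X(ℝ) ≠ ∅), ℤ-sections = abelian descent at the finite places, coupling = one adelic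
point surviving both. This level dominates k-consistency, Sherali–Adams, Lasserre (Dawar–Wang
LICS17: Ω(n) Lasserre levels for K₃), AIP, BLP+AIP, BAᵏ, CLAP, SDA and cohomological k-consistency
(it implies crux A's level at the same k). Expected proof: ℤ₂- and ℤ₃-Tseitin systems on expanders,
OR-glued (Lichter–Pago §3.2), pp-interpreted in K₃; Grigoriev–Schoenebeck pseudoexpectations +
Tulsiani-style gadget transfer for E, Berkholz–Grohe p-solutions for r; isolated-vertex padding
gives every n. Implies crux A. -/
@[route_item "route-PneNP-DescentTower"]
def JointSublinearFooling : Prop :=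
  ∀ k : ℕ → ℕ, Filter.Tendsto (fun n : ℕ => (k n : ℝ) / n) Filter.atTop (nhds 0) → ∀ᶠ n : ℕ in Filter.atTop, ∃ G : SimpleGraph (Fin n), ¬ G.Colorable 3 ∧ ∃ E : MvPolynomial ℕ ℝ →ₗ[ℝ] ℝ, Literature.Computability.MetaComplexity.IsPseudoexpectation (2 * (k n)) E ∧ (∀ i : ℕ, Literature.Computability.MetaComplexity.SatisfiesIdentity (2 * (k n)) E (Literature.Computability.MetaComplexity.boolAxiom i)) ∧ (∀ v : Fin n, Literature.Computability.MetaComplexity.SatisfiesIdentity (2 * (k n)) E (1 - ∑ c : Fin 3, MvPolynomial.X (3 * v.val + c.val))) ∧ (∀ u v : Fin n, G.Adj u v → ∀ c : Fin 3, Literature.Computability.MetaComplexity.SatisfiesIdentity (2 * (k n)) E (MvPolynomial.X (3 * u.val + c.val) * MvPolynomial.X (3 * v.val + c.val))) ∧ ∀ p : Finset (Fin n) × (Fin n → Fin 3), p.1.card ≤ (k n) → (∀ v, v ∉ p.1 → p.2 v = 0) → 0 < E (∏ v ∈ p.1, MvPolynomial.X (3 * v.val + (p.2 v).val)) → ∃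 r : Finset (Fin n) → (Fin n → Fin 3) → ℤ, (∀ U t, r U t ≠ 0 → U.card ≤ (k n) ∧ (∀ v, v ∉ U → t v = 0) ∧ 0 < E (∏ v ∈ U, MvPolynomial.X (3 * v.val + (t v).val))) ∧ (∀ U D : Finset (Fin n), D ⊆ U → U.card ≤ (k n) → ∀ t' : Fin n → Fin 3, r D t' = ∑ t : Fin n → Fin 3, if (∀ v, t' v = if v ∈ D then t v else 0) then r U t else 0) ∧ r p.1 p.2 = 1 ∧ ∀ t, t ≠ p.2 → r p.1 t = 0

/-- item stmt-PneNP-2539 · crux · rank 4 · open · by planner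
why it might fail: Likely FALSE as filed: a P-uniform explicit fooling family {G_n} — what B's planned proof builds (OR-glued ℤ₂/ℤ₃-Tseitin on explicit expanders, gadget-coded in K₃; Grigoriev 2001, Lichter–Pago Thm 5.9) — is itself a sound refuter R ∈ P no sublinear level dominates: explicit-B ⇒ ¬C. Relativizes, too.
sources: doi:10.1016/S0304-3975(00)00157-2, LichterPago2025, doi:10.1145/3618260.3649613, doi:10.1145/1536414.1536457, BakerGillSolovay1975
[crux C — CAPTURE, the summit-strength layer: P ≠ NP hides here] Every polynomial-time SOUND REFUTER
of 3-colourability (R ∈ P containing no code of a 3-colourable graph) is DOMINATED by a sublinear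
coupled level: for some k(n) = o(n) and all large n every n-vertex graph flagged by R is rejected by
crux B's level at k(n). Non-vacuous and auditable refuter by refuter: fixed subgraph obstructions
(K₄, odd wheels, bounded Hajós derivations) ↦ k = O(1); brute force / treewidth-DP on components of
size O(log n) ↦ k = O(log n) (a FIXED level is beaten by padding — hence sublinear); Hoffman, Lovász
ϑ, vector colouring, Sherali–Adams, Lasserre ↦ the E-part; Gaussian elimination over finite rings,
ℤ-affine consistency, BLP+AIP, BAᵏ, CLAP, SDA, cohomological consistency ↦ the coupled ℤ-part (Ó
Conghaile Thm 'rings'; an UNcoupled union would miss BAᵏ); bounded-degree Nullstellensatz/PC ↦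
affine consistency / SOS (Berkholz STACS18). With crux B it gives ThreeColNotInP (TargetOfCruxes).
Attack first the restricted forms: FPC-definable refuters (via Dawar–Wang), template-uniform CSP
algorithms (Lichter–Pago's open question p.5 is the litmus), proof search p-simulated by SOS +
linear algebra. -/
@[route_item "route-PneNP-DescentTower"]
def CaptureSublinear : Prop :=
  ∀ R : Language Bool, R ∈ Literature.Computability.Complexity.Classes.P → (∀ (n : ℕ) (G : SimpleGraph (Fin n)), Literature.Computability.Complexity.encodingGraph.encode ⟨n, G⟩ ∈ R → ¬ G.Colorable 3) → ∃ k : ℕ → ℕ, Filter.Tendsto (fun n : ℕ => (k n : ℝ) / n) Filter.atTop (nhds 0) ∧ ∀ᶠ n : ℕ in Filter.atTop, ∀ G : SimpleGraph (Fin n), Literature.Computability.Complexity.encodingGraph.encode ⟨n, G⟩ ∈ R → ¬ (∃ E : MvPolynomial ℕ ℝ →ₗ[ℝ] ℝ, Literature.Computability.MetaComplexity.IsPseudoexpectation (2 * (k n)) E ∧ (∀ i : ℕ, Literature.Computability.MetaComplexity.SatisfiesIdentity (2 * (k n)) E (Literature.Computability.MetaComplexity.boolAxiom i)) ∧ (∀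 v : Fin n, Literature.Computability.MetaComplexity.SatisfiesIdentity (2 * (k n)) E (1 - ∑ c : Fin 3, MvPolynomial.X (3 * v.val + c.val))) ∧ (∀ u v : Fin n, G.Adj u v → ∀ c : Fin 3, Literature.Computability.MetaComplexity.SatisfiesIdentity (2 * (k n)) E (MvPolynomial.X (3 * u.val + c.val) * MvPolynomial.X (3 * v.val + c.val))) ∧ ∀ p : Finset (Fin n) × (Fin n → Fin 3), p.1.card ≤ (k n) → (∀ v, v ∉ p.1 → p.2 v = 0) → 0 < E (∏ v ∈ p.1, MvPolynomial.X (3 * v.val + (p.2 v).val)) → ∃ r : Finset (Fin n) → (Fin n → Fin 3) → ℤ, (∀ U t, r U t ≠ 0 → U.card ≤ (k n) ∧ (∀ v, v ∉ U → t v = 0) ∧ 0 < E (∏ v ∈ U, MvPolynomial.X (3 * v.val + (t v).val))) ∧ (∀ U D : Finset (Fin n), D ⊆ U → U.card ≤ (k n) → ∀ t' : Fin n → Fin 3, r D t' = ∑ t : Fin n → Fin 3, if (∀ v, t' v = if v ∈ D then t v else 0) then r U t else 0) ∧ r p.1 p.2 = 1 ∧ ∀ t, t ≠ p.2 → r p.1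 t = 0)

/-- item stmt-PneNP-2537 · support · rank 2 · open · by planner
why it might fail: May already be KNOWN if K₃ is 'lax + null-constraining' in Chan–Ng II (doi:10.1145/3717823.3718301, paywalled; then re-file as cite); may fail AS STATED if the inline rendering of Def. 5 is off (LevelsSound guards one direction); transfer from the designed template needs an unproved gadget lemma.
sources: doi:10.1145/3717823.3718301, LichterPago2025, doi:10.1145/3618260.3649613, OConghaile2022
[crux A — first rung; isolates the one unknown ingredient] For every k some non-3-colourable graph
passes Ó CONGHAILE'S COHOMOLOGICAL k-CONSISTENCY w.r.t. K₃ (MFCS 2022 Def. 5) as a self-supporting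
family: a nonempty family H of partial proper 3-colourings (C, s), |C| ≤ k (s normalised to 0 off
C), restriction-closed, forth below size k, every member ℤ-EXTENDABLE inside H (compatible formal
ℤ-combinations r_U of members over all contexts |U| ≤ k with r_C = 1·s); the gfp algorithm accepts
iff such a family exists. Level L₁(ℤ,k) = abelian descent: decides all linear systems over finite
rings (Ó Conghaile Thm 'rings'), beats ℤ-affine consistency/BLP+AIP/BAᵏ/CLAP (Lichter–Pago Thm
1.1–1.2). KNOWN: a DESIGNED NP-complete template fools it for all k = o(n) (Lichter–Pago, arXiv v3
Thm 1.2 = ICALP25 Thm 1.3: OR-glued ℤ₂/ℤ₃ Tseitin systems); random lax null-constraining templates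
do (Chan–Ng STOC25). NOT KNOWN for K₃: expected proof = transfer along a pp-interpretation of that
template in K₃ (informal support TransferUnderGadgets) or a direct expander construction on graphs.
False for some k ⇒ P = NP-strength event (the level is polynomial-time). -/
@[route_item "route-PneNP-DescentTower"]
def CohConsistencyFooledByThreeCol : Prop :=
  ∀ k : ℕ, ∃ (n : ℕ) (G : SimpleGraph (Fin n)), ¬ G.Colorable 3 ∧ ∃ H : Set (Finset (Fin n) × (Fin n → Fin 3)), H.Nonempty ∧ ∀ p ∈ H, p.1.card ≤ k ∧ (∀ v, v ∉ p.1 → p.2 v = 0) ∧ (∀ u ∈ p.1, ∀ v ∈ p.1, G.Adj u v → p.2 u ≠ p.2 v) ∧ (∀ D ⊆ p.1, (D, fun v => if v ∈ D then p.2 v else 0) ∈ H) ∧ (p.1.card < k → ∀ x : Fin n, ∃ t : Fin n → Fin 3, (insert x p.1, t) ∈ H ∧ ∀ v ∈ p.1, t v = p.2 v) ∧ ∃ r : Finset (Fin n) → (Fin n → Fin 3) → ℤ, (∀ U t, r U t ≠ 0 → (U, t) ∈ H) ∧ (∀ U D : Finset (Fin n), D ⊆ U → U.card ≤ k → ∀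 t' : Fin n → Fin 3, r D t' = ∑ t : Fin n → Fin 3, if (∀ v, t' v = if v ∈ D then t v else 0) then r U t else 0) ∧ r p.1 p.2 = 1 ∧ ∀ t, t ≠ p.2 → r p.1 t = 0

/-- item stmt-PneNP-17750 · support · rank 9 · open · by planner
sources: folklore
[support — ASSEMBLY of the crux-strategist split of ThreeColNotInP (BC2 redirect, stmt-PneNP-2536),
provable NOW; planner-checked Sketch.lean rc0, sorry-free, 20 lines] If 3-COL ∈ P then the
complement R of the 3-COL language is a sound refuter in P (compl_mem_P_iff, mem_toLanguage_iff) and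
R is homomorphism-monotone on codes (a 3-colouring C of H pulls back along φ : G →g H as ⟨C.comp
φ⟩); CaptureHom gives a sublinear k whose coupled level rejects every R-flagged graph for large n;
JointSublinearFooling at the same k supplies, for large n, a non-3-colourable (hence R-flagged)
graph passing that level; Eventually.and → False. Supersedes TargetOfCruxes (which needs the
suspect-false CaptureSublinear) as the derivation of the target; CaptureSublinear → CaptureHom, so
nothing proved is lost. -/
@[route_item "route-PneNP-DescentTower"]
def ThreeColNotInPOfCaptureHom : Prop :=
  CaptureHom → JointSublinearFooling → ThreeColNotInP

/-- item stmt-PneNP-2540 · support · rank 9 · closed · proved by Summit.PneNP.PneNP.Theorems.descentTower_targetOfCruxes_proof @ 03499e28ab32 (prover) · by planner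
[support — layer-2 glue, provable NOW] If 3-COL ∈ P then its complement R is a sound refuter in P
(compl_mem_P_iff, mem_toLanguage_iff); CaptureSublinear gives a sublinear k with the coupled level
k(n) rejecting every non-3-colourable graph for large n; JointSublinearFooling at the same k gives
an accepted non-3-colourable graph for large n; Eventually.and → contradiction. Checked in the
planner's Sketch.lean (≈ 15 lines). -/
@[route_item "route-PneNP-DescentTower"]
def TargetOfCruxes : Prop :=
  CaptureSublinear → JointSublinearFooling → ThreeColNotInP

/-- item stmt-PneNP-2541 · support · rank 9 · closed · proved by Summit.PneNP.PneNP.Theorems.descentTower_threeColKarpReducibleChromatic_proof @ 5a32a38a8f62 (prover) · by planner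
[support — routine machine, needed by the Assembly] 3-COL ≤ₚ CHROMATIC NUMBER via G ↦ (G, 3): the
map x ↦ pairBool-code of (x, binary 3) in the tree's encodings (encodingGraph.pairBool
encodingNatBool); correctness by mem_CHROMATIC_iff / mem_toLanguage_iff, invalid codes map to
invalid codes. Gives 3-COL ∈ NP from ChromaticNP.CHROMATIC_mem_NP and mem_NP_of_karpReducible_holds. -/
@[route_item "route-PneNP-DescentTower", crux]
def ThreeColKarpReducibleChromatic : Prop :=
  Literature.Computability.Complexity.PolyTimeKarpReducible (Literature.Computability.Complexity.encodingGraph.toLanguage {G : Σ n, SimpleGraph (Fin n) | G.2.Colorable 3}) Literature.Computability.Complexity.CHROMATIC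

/-- item stmt-PneNP-2542 · support · rank 9 · closed · proved by Summit.PneNP.PneNP.Theorems.descentTower_levelsSound_proof @ 350bbaa4dcb9 (prover) · by planner
[support — definition sanity, provable NOW] A 3-colourable graph is accepted by every level: take E
= evaluation at the 0/1 point of a colouring c (as in SumOfSquares.sosFailsToRefute_of_forall_eval),
H = the restrictions of c to ≤ k-sets, r_U = the indicator of c|_U. Guards the inline renderings
used in cruxes A–C against vacuity in the wrong direction (the other direction — K₄ is rejected at
level 4 — is a finite check). -/
@[route_item "route-PneNP-DescentTower"]
def LevelsSound : Prop :=
  ∀ (n : ℕ) (G : SimpleGraph (Fin n)), G.Colorable 3 → ∀ k : ℕ, (∃ E : MvPolynomial ℕ ℝ →ₗ[ℝ] ℝ, Literature.Computability.MetaComplexity.IsPseudoexpectation (2 * k) E ∧ (∀ i : ℕ, Literature.Computability.MetaComplexity.SatisfiesIdentity (2 * k) E (Literature.Computability.MetaComplexity.boolAxiom i)) ∧ (∀ v : Fin n, Literature.Computability.MetaComplexity.SatisfiesIdentity (2 * k) E (1 - ∑ c : Fin 3, MvPolynomial.X (3 * v.val + c.val))) ∧ (∀ u v : Fin n, G.Adj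 u v → ∀ c : Fin 3, Literature.Computability.MetaComplexity.SatisfiesIdentity (2 * k) E (MvPolynomial.X (3 * u.val + c.val) * MvPolynomial.X (3 * v.val + c.val))) ∧ ∀ p : Finset (Fin n) × (Fin n → Fin 3), p.1.card ≤ k → (∀ v, v ∉ p.1 → p.2 v = 0) → 0 < E (∏ v ∈ p.1, MvPolynomial.X (3 * v.val + (p.2 v).val)) → ∃ r : Finset (Fin n) → (Fin n → Fin 3) → ℤ, (∀ U t, r U t ≠ 0 → U.card ≤ k ∧ (∀ v, v ∉ U → t v = 0) ∧ 0 < E (∏ v ∈ U, MvPolynomial.X (3 * v.val + (t v).val))) ∧ (∀ U D : Finset (Fin n), D ⊆ U → U.card ≤ k → ∀ t' : Fin n → Fin 3, r D t' = ∑ t : Fin n → Fin 3, if (∀ v, t' v = if v ∈ D then t v else 0) then r U t else 0) ∧ r p.1 p.2 = 1 ∧ ∀ t, t ≠ p.2 → r p.1 t = 0) ∧ (∃ H : Set (Finset (Fin n) × (Fin n → Fin 3)), H.Nonempty ∧ ∀ p ∈ H, p.1.card ≤ k ∧ (∀ v, v ∉ p.1 → p.2 v = 0) ∧ (∀ u ∈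 p.1, ∀ v ∈ p.1, G.Adj u v → p.2 u ≠ p.2 v) ∧ (∀ D ⊆ p.1, (D, fun v => if v ∈ D then p.2 v else 0) ∈ H) ∧ (p.1.card < k → ∀ x : Fin n, ∃ t : Fin n → Fin 3, (insert x p.1, t) ∈ H ∧ ∀ v ∈ p.1, t v = p.2 v) ∧ ∃ r : Finset (Fin n) → (Fin n → Fin 3) → ℤ, (∀ U t, r U t ≠ 0 → (U, t) ∈ H) ∧ (∀ U D : Finset (Fin n), D ⊆ U → U.card ≤ k → ∀ t' : Fin n → Fin 3, r D t' = ∑ t : Fin n → Fin 3, if (∀ v, t' v = if v ∈ D then t v else 0) then r U t else 0) ∧ r p.1 p.2 = 1 ∧ ∀ t, t ≠ p.2 → r p.1 t = 0)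

/-- item stmt-PneNP-2543 · support · rank 9 · closed · proved by Summit.PneNP.PneNP.Theorems.descentTower_fixingAbsorption_proof @ 3a09038de107 (prover) · by planner
[support — planner's structural lemma, provable NOW; it prunes the card] SINGLETON (nested-fixing)
cohomological k-consistency — outer k-consistent family H, and for each member p = (C, s) a
self-supporting sub-family H' ⊆ H of p-compatible sections containing p (restriction-closed, forth <
k, ℤ-extendable inside H'), i.e. 'fix a partial homomorphism, re-run the whole algorithm, prune'
(Lichter–Pago p.5; Zhuk 2025 singleton algorithms) — is already implied by plain cohomological
2k-consistency: from the 2k-family take H = members of size ≤ k and H'_p = {(V, t) : (V ∪ C, t ∪ s)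
in the 2k-family}, pushing the ℤ-section of (U ∪ C, t ∪ s) forward along w ↦ w|_V. By induction
fixing depth d at width k ⟸ depth 1 at width d·k, so the card's 'fixing depth / OR-depth hierarchy'
(its crux C1) collapses into the width axis for every constant or sublinear k and is NOT filed as a
crux; its base case is Lichter–Pago Thm 1.2. A refutation of this lemma would resurrect C1. -/
@[route_item "route-PneNP-DescentTower"]
def FixingAbsorption : Prop :=
  ∀ (n : ℕ) (G : SimpleGraph (Fin n)) (k : ℕ), (∃ H : Set (Finset (Fin n) × (Fin n → Fin 3)), H.Nonempty ∧ ∀ p ∈ H, p.1.card ≤ (2 * k) ∧ (∀ v, v ∉ p.1 → p.2 v = 0) ∧ (∀ u ∈ p.1, ∀ v ∈ p.1, G.Adj u v → p.2 u ≠ p.2 v) ∧ (∀ D ⊆ p.1, (D, fun v => if v ∈ D then p.2 v else 0) ∈ H) ∧ (p.1.card < (2 * k) → ∀ x : Fin n, ∃ t : Fin n → Fin 3, (insert x p.1, t) ∈ H ∧ ∀ v ∈ p.1, t v = p.2 v) ∧ ∃ r : Finset (Fin n) → (Fin n → Fin 3) → ℤ, (∀ U t, r U t ≠ 0 → (U,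 t) ∈ H) ∧ (∀ U D : Finset (Fin n), D ⊆ U → U.card ≤ (2 * k) → ∀ t' : Fin n → Fin 3, r D t' = ∑ t : Fin n → Fin 3, if (∀ v, t' v = if v ∈ D then t v else 0) then r U t else 0) ∧ r p.1 p.2 = 1 ∧ ∀ t, t ≠ p.2 → r p.1 t = 0) → ∃ H : Set (Finset (Fin n) × (Fin n → Fin 3)), H.Nonempty ∧ (∀ p ∈ H, p.1.card ≤ k ∧ (∀ v, v ∉ p.1 → p.2 v = 0) ∧ (∀ u ∈ p.1, ∀ v ∈ p.1, G.Adj u v → p.2 u ≠ p.2 v) ∧ (∀ D ⊆ p.1, (D, fun v => if v ∈ D then p.2 v else 0) ∈ H) ∧ (p.1.card < k → ∀ x : Fin n, ∃ t : Fin n → Fin 3, (insert x p.1, t) ∈ H ∧ ∀ v ∈ p.1, t v = p.2 v)) ∧ ∀ p ∈ H, ∃ H' : Set (Finset (Fin n) × (Fin n → Fin 3)), H' ⊆ H ∧ p ∈ H' ∧ ∀ q ∈ H', (∀ v ∈ q.1, v ∈ p.1 → q.2 v = p.2 v) ∧ (∀ D ⊆ q.1, (D, fun v => if v ∈ D then q.2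 v else 0) ∈ H') ∧ (q.1.card < k → ∀ x : Fin n, ∃ t : Fin n → Fin 3, (insert x q.1, t) ∈ H' ∧ ∀ v ∈ q.1, t v = q.2 v) ∧ ∃ r : Finset (Fin n) → (Fin n → Fin 3) → ℤ, (∀ U t, r U t ≠ 0 → (U, t) ∈ H') ∧ (∀ U D : Finset (Fin n), D ⊆ U → U.card ≤ k → ∀ t' : Fin n → Fin 3, r D t' = ∑ t : Fin n → Fin 3, if (∀ v, t' v = if v ∈ D then t v else 0) then r U t else 0) ∧ r q.1 q.2 = 1 ∧ ∀ t, t ≠ q.2 → r q.1 t = 0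

-- item stmt-PneNP-2679 · support · rank 9 · open · by planner — informal only, no Lean statement yet:
--   [support — informal until general-structure definitions land (definition requests
--   CohomologicallyKConsistent, PPInterpretation); the card's crux C3 demoted to the proof route of crux
--   A] TRANSFER UNDER GADGETS: if a finite template B is pp-interpretable in K₃ (every finite structure
--   is, K₃'s polymorphism clone being essentially trivial) via an interpretation of dimension m with
--   gadgets of size ≤ g, then for every instance I of CSP(B) with n elements the standard gadget graph
--   Γ(I) (O(m·n + g·|constraints|) vertices) satisfies: I cohomologically k'-consistent w.r.t. B ⇒ Γ(I)
--   cohomologically k-con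

-- earlier Assembly (stmt-PneNP-2544, replaced 2026-08-15T16:21:09Z -> stmt-PneNP-10686): retired by None — Literature.Computability.Complexity.P_bool_eq → Literature.Computability.Complexity.NP_bool_eq → ThreeColKarpReducibleChromatic → ThreeColNotInP → PneNP
/-- item stmt-PneNP-10686 · assembly · rank 1 · closed · proved by Summit.PneNP.PneNP.Theorems.descentTower_assembly_proof @ 47fcb8ead3b0 (prover) · by planner
[assembly] bridge-free (rev 2): 3-COL ≤ₚ CHROMATIC (item ThreeColKarpReducibleChromatic) and 3-COL ∉
P (target ThreeColNotInP) give P ≠ NP in Cook's classes of the Statement. Provable NOW in a Theorems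
file importing NPBridge + ChromaticNP: CHROMATIC ∈ NP (ChromaticNP.CHROMATIC_mem_NP) and NP closed
under ≤ₚ (mem_NP_of_karpReducible_holds) put 3-COL in Nondeterministic.NP; the PROVED model bridges
np_bool_eq : PNPWave0.NP Bool = Nondeterministic.NP and P_bool_eq_holds : PNPWave0.P Bool =
Classes.P are used INSIDE the proof (never as hypotheses — that was the rev-1 defect
glue.extra-hypothesis). Planner-checked: Sketch3.lean rc 0, axioms {propext, Classical.choice,
Quot.sound}; 8-line proof attached as evidence. The cruxes enter through TargetOfCruxes
(CaptureSublinear → JointSublinearFooling → ThreeColNotInP); the deciding theorem is closes := fun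
hT hK hA => hA hK hT. -/
@[route_item "route-PneNP-DescentTower", crux]
def Assembly : Prop :=
  ThreeColKarpReducibleChromatic → ThreeColNotInP → _root_.PneNP

/-! D-0027 §2.1 — DECIDING THEOREM (planner-authored via `route open/edit --closes-file`; by planner-rbadge-PneNP-DescentTower-5d67ad1f-g2-0 2026-08-15T16:21:09Z):
its hypotheses are this route's items and its conclusion the sub-problem Statement (glue_lint), and it elaborates with this file. -/

@[closes "route-PneNP-DescentTower"] theorem closes (hT : ThreeColNotInP) (hK : ThreeColKarpReducibleChromatic) (hA : Assembly) : _root_.PneNP :=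
  hA hK hT

end Summit.PneNP.PneNP.Theses.DescentTower
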